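import Literature.Analysis.UnboundedOperators.HeatKernelBoundedData
import Literature.Analysis.UnboundedOperators.HeatFlowCalculus
import HarnessLib

/-!
# The commutator of the heat flow with a Lipschitz cutoff, for a field bounded near the cutoff
# and square integrable far away

Analysis/UnboundedOperators-side support file placed in FluidPDE (everything proved; no definitions,
no named facts). Three tools of the LOCALISED blow-up (zoom) argument for Navier–Stokes at a
prescribed singular point (Koch–Nadirashvili–Seregin–Šverák 2009, proof of Thm. 6.2, where the zooms
are controlled only on growing cylinders): a truncated zoom `χ w` obeys the Oseen identity up to a
commutator `χ(z) e^{hΔ}w(z) − e^{hΔ}(χ w)(z) = ∫ G_h(y) (χ(z) − χ(z − y)) w(z − y) dy`, which must be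
`O(√h)` UNIFORMLY in `z` although `w` is bounded only on a ball and merely square integrable outside.

* `exists_lipschitz_cutoff` — for `R > 0` an explicit cutoff `χ : E → [0, 1]`, `χ = 1` on
  `B̄(0, R/2)`, `χ = 0` off `B(0, 3R/4)`, `|χ(y) − χ(z)| ≤ (4/R)‖y − z‖`, continuous
  (`χ(y) = max 0 (min 1 (3 − 4‖y‖/R))`);
* `norm_heatCommutator_le` — for `0 < h ≤ 1`, a cutoff `χ` with values in `[0,1]`, Lipschitz
  constant `L`, vanishing off `B(0, R − ρ)` (`ρ > 0`), and a continuous field `f` bounded by `m` on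
  `B(0, R)`, bounded by some constant everywhere and with `∫ ‖f‖² ≤ 𝓔`:
  `‖χ(z) e^{hΔ}f(z) − e^{hΔ}(χ f)(z)‖ ≤ 2·2^{d/2} m L √h + (4πh)^{-d/2} e^{-ρ²/(8h)} ((4π)^{d/2} + 𝓔)/2`
  at EVERY `z`: near the diagonal (`‖y‖ ≤ ρ`) the Lipschitz bound of `χ` meets the first moment of
  the heat kernel (`integral_heatKernel_mul_norm_le`) and `f` is evaluated inside `B(0, R)`; off the
  diagonal the off-diagonal Gaussian bound `heatKernel_le_of_le_norm` and `2ab ≤ a² + b²`;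
* `offDiagonal_factor_le_sqrt` — in dimension `3`, `(4πh)^{-3/2} e^{-ρ²/(8h)} ≤ 128 (4π)^{-3/2} ρ⁻⁴ √h`
  for `h > 0` (`x²/2 ≤ eˣ`), so that the commutator is `O(√h)` uniformly, with a constant that
  VANISHES as `ρ → ∞`.

Consumer: `Summits/NavierStokesRegularity/FluidComputer/ClayBlowupLocalZoom.lean` (cell `ns-blowup`,
seat ecbridge-2 g11: the localised zoom with force at a singular point of a Clay blow-up).

## Mathlib / tree search

Tree: `UnboundedOperators.heatExtension_apply`, `integrable_heatKernel_smul_of_bound`,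
`integral_heatKernel_mul_norm_le`, `heatKernel_le_of_le_norm`, `heatKernel_pos`,
`integrable_heatKernel_holds` (`HeatKernel*`); `lean search 'commutator.*heat|heat.*cutoff'`: nothing
for the heat flow against a cutoff. Mathlib: `GaussianFourier.integral_rexp_neg_mul_sq_norm`,
`Real.pow_div_factorial_le_exp`, `norm_integral_le_of_norm_le`, `integral_sub_left_eq_self`.

## References

* G. Koch, N. Nadirashvili, G. Seregin, V. Šverák, *Liouville theorems for the Navier–Stokes
  equations and applications*, Acta Math. 203 (2009) = arXiv:0709.3599, §3 (3.7)–(3.8) (heat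
  potentials of bounded data) and proof of Thm. 6.2 p. 13 (control on growing cylinders only).
  [KochNadirashviliSereginSverak2009]
* L. C. Evans, *Partial Differential Equations*, 2nd ed., AMS 2010, §2.3.1 (the heat kernel, its mass
  and Gaussian form). [Evans2010]
-/

noncomputable section

open MeasureTheory Set Function Filter Metric Real
open _root_.Topology
open scoped ENNReal NNReal

namespace Literature.Analysis.FluidPDE

open UnboundedOperators

variable {E : Type*} [NormedAddCommGroup E] [InnerProductSpace ℝ E] [FiniteDimensional ℝ E]
  [MeasurableSpace E] [BorelSpace E]
variable {F : Type*} [NormedAddCommGroup F] [NormedSpace ℝ F]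

/-! ## §1 An explicit Lipschitz cutoff -/

omit [InnerProductSpace ℝ E] [FiniteDimensional ℝ E] [MeasurableSpace E] [BorelSpace E] in
/-- **A Lipschitz cutoff adapted to the ball `B(0, R)`**: `χ(y) = max 0 (min 1 (3 − 4‖y‖/R))` takes
values in `[0, 1]`, equals `1` on `B̄(0, R/2)`, vanishes off `B(0, 3R/4)`, is `(4/R)`-Lipschitz and
continuous. [cite: KochNadirashviliSereginSverak2009, proof of Thm 6.2 (arXiv p. 13)] -/
theorem exists_lipschitz_cutoff [NormedSpace ℝ E] {R : ℝ} (hR : 0 < R) :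
    ∃ χ : E → ℝ, (∀ y, 0 ≤ χ y ∧ χ y ≤ 1) ∧ (∀ y, ‖y‖ ≤ R / 2 → χ y = 1) ∧
      (∀ y, 3 * R / 4 ≤ ‖y‖ → χ y = 0) ∧ (∀ y z, |χ y - χ z| ≤ 4 / R * ‖y - z‖) ∧ Continuous χ := by
  have hlip : LipschitzWith 1 (fun t : ℝ => max 0 (min 1 t)) :=
    (LipschitzWith.id.const_min 1).const_max 0
  refine ⟨fun y => max 0 (min 1 (3 - 4 * ‖y‖ / R)), fun y => ⟨le_max_left _ _,
    max_le zero_le_one (min_le_left _ _)⟩, fun y hy => ?_, fun y hy => ?_, fun y z => ?_, ?_⟩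
  · have h0 : 4 * ‖y‖ / R ≤ 2 := by rw [div_le_iff₀ hR]; linarith
    have h1 : 1 ≤ 3 - 4 * ‖y‖ / R := by linarith
    show max 0 (min 1 (3 - 4 * ‖y‖ / R)) = 1
    rw [min_eq_left h1, max_eq_right zero_le_one]
  · have h0 : 3 ≤ 4 * ‖y‖ / R := by rw [le_div_iff₀ hR]; linarith
    have h1 : 3 - 4 * ‖y‖ / R ≤ 0 := by linarith
    show max 0 (min 1 (3 - 4 * ‖y‖ / R)) = 0
    rw [min_eq_right (h1.trans zero_le_one), max_eq_left h1]
  · show |max 0 (min 1 (3 - 4 * ‖y‖ / R)) - max 0 (min 1 (3 - 4 * ‖z‖ / R))| ≤ 4 / R * ‖y - z‖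
    have h1 := hlip.dist_le_mul (3 - 4 * ‖y‖ / R) (3 - 4 * ‖z‖ / R)
    simp only [NNReal.coe_one, one_mul, Real.dist_eq] at h1
    refine h1.trans ?_
    have h2 : (3 - 4 * ‖y‖ / R) - (3 - 4 * ‖z‖ / R) = 4 / R * (‖z‖ - ‖y‖) := by ring
    rw [h2, abs_mul, abs_of_pos (by positivity : (0 : ℝ) < 4 / R)]
    refine mul_le_mul_of_nonneg_left ?_ (by positivity)
    rw [abs_sub_comm]
    exact abs_norm_sub_norm_le y z
  · fun_prop

/-! ## §2 The commutator estimate -/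

omit [InnerProductSpace ℝ E] [FiniteDimensional ℝ E] [MeasurableSpace E] [BorelSpace E] in
/-- `2ab ≤ a² + b²` in the form `e^{−‖y‖²/8} b ≤ (e^{−‖y‖²/4} + b²)/2`. [folklore]
[cite: Evans2010, §2.3.1] -/
theorem exp_mul_le_half_add_sq (y : E) (b : ℝ) :
    Real.exp (-(1 / 8) * ‖y‖ ^ 2) * b ≤ (Real.exp (-(1 / 4) * ‖y‖ ^ 2) + b ^ 2) / 2 := by
  have h1 : Real.exp (-(1 / 8) * ‖y‖ ^ 2) ^ 2 = Real.exp (-(1 / 4) * ‖y‖ ^ 2) := by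
    rw [← Real.exp_nat_mul]; congr 1; ring
  nlinarith [sq_nonneg (Real.exp (-(1 / 8) * ‖y‖ ^ 2) - b), h1]

/-- **The commutator of the heat flow with a Lipschitz cutoff** (`0 < h ≤ 1`). Let `χ : E → [0,1]` be
`L`-Lipschitz and vanish off `B(0, R − ρ)` (`ρ > 0`); let `f : E → F` be continuous, bounded by `M₀`
everywhere, by `m` on `B(0, R)`, with `‖f‖²` integrable and `∫ ‖f‖² ≤ 𝓔`. Then for every `z`,
`‖χ(z) e^{hΔ}f(z) − e^{hΔ}(χ f)(z)‖ ≤ 2·2^{d/2} m L √h + (4πh)^{-d/2} e^{-ρ²/(8h)} ((4π)^{d/2} + 𝓔)/2`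
(`d = dim E`). Mechanism: KNSS 2009, (3.7)–(3.8) (heat potentials of bounded data) near the diagonal,
the off-diagonal Gaussian bound far from it. [cite: KochNadirashviliSereginSverak2009, §3 (3.7)–(3.8) and proof of Thm 6.2 (arXiv pp. 6, 13)] -/
theorem norm_heatCommutator_le {h R ρ m L M₀ 𝓔 : ℝ} {χ : E → ℝ} {f : E → F} (hh : 0 < h)
    (hh1 : h ≤ 1) (hρ : 0 < ρ) (hm : 0 ≤ m) (hL : 0 ≤ L)
    (hχ01 : ∀ y, 0 ≤ χ y ∧ χ y ≤ 1) (hχL : ∀ y z, |χ y - χ z| ≤ L * ‖y - z‖)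
    (hχsupp : ∀ y, χ y ≠ 0 → ‖y‖ < R - ρ) (hχc : Continuous χ)
    (hfc : Continuous f) (hfM : ∀ y, ‖f y‖ ≤ M₀) (hfm : ∀ y, ‖y‖ < R → ‖f y‖ ≤ m)
    (hfi : Integrable (fun y => ‖f y‖ ^ 2)) (hfE : ∫ y, ‖f y‖ ^ 2 ≤ 𝓔) (z : E) :
    ‖χ z • heatExtension f h z - heatExtension (fun y => χ y • f y) h z‖ ≤
      2 * (2 : ℝ) ^ ((Module.finrank ℝ E : ℝ) / 2) * m * L * Real.sqrt h +
        (4 * π * h) ^ (-(Module.finrank ℝ E : ℝ) / 2) * Real.exp (-(ρ ^ 2 / (8 * h))) *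
          (((4 * π) ^ ((Module.finrank ℝ E : ℝ) / 2) + 𝓔) / 2) := by
  set d : ℝ := (Module.finrank ℝ E : ℝ) with hd
  set K : ℝ := (4 * π * h) ^ (-d / 2) * Real.exp (-(ρ ^ 2 / (8 * h))) with hK
  have hK0 : 0 ≤ K := by rw [hK]; positivity
  have hM₀0 : 0 ≤ M₀ := (norm_nonneg _).trans (hfM 0)
  -- ### the commutator as ONE integral
  have hχf_c : Continuous fun y => χ y • f y := hχc.smul hfc
  have hχf_b : ∀ y, ‖χ y • f y‖ ≤ M₀ := fun y => by
    rw [norm_smul, Real.norm_of_nonneg (hχ01 y).1]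
    exact (mul_le_of_le_one_left (norm_nonneg _) (hχ01 y).2).trans (hfM y)
  have hI1 : Integrable (fun y => heatKernel h y • f (z - y)) :=
    integrable_heatKernel_smul_of_bound hfc hfM hh z
  have hI2 : Integrable (fun y => heatKernel h y • (χ (z - y) • f (z - y))) :=
    integrable_heatKernel_smul_of_bound (g := fun y => χ y • f y) hχf_c hχf_b hh z
  have hI1' : Integrable (fun y => χ z • (heatKernel h y • f (z - y))) := hI1.smul (χ z)
  have hcomm : χ z • heatExtension f h z - heatExtension (fun y => χ y • f y) h z =
      ∫ y, heatKernel h y • ((χ z - χ (z - y)) • f (z - y)) := by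
    rw [heatExtension_apply, heatExtension_apply, ← integral_smul, ← integral_sub hI1' hI2]
    refine integral_congr_ae (Eventually.of_forall fun y => ?_)
    show χ z • (heatKernel h y • f (z - y)) - heatKernel h y • (χ (z - y) • f (z - y)) =
      heatKernel h y • ((χ z - χ (z - y)) • f (z - y))
    rw [smul_smul, smul_smul, smul_smul, ← sub_smul]
    congr 1
    ring
  -- ### the pointwise bound
  set g : E → ℝ := fun y => m * L * (heatKernel h y * ‖y‖) +
    K * ((Real.exp (-(1 / 4) * ‖y‖ ^ 2) + ‖f (z - y)‖ ^ 2) / 2) with hg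
  have hpt : ∀ y, ‖heatKernel h y • ((χ z - χ (z - y)) • f (z - y))‖ ≤ g y := by
    intro y
    have hG0 : 0 ≤ heatKernel h y := (heatKernel_pos hh y).le
    rw [norm_smul, norm_smul, Real.norm_of_nonneg hG0, Real.norm_eq_abs]
    have hterm1 : 0 ≤ m * L * (heatKernel h y * ‖y‖) := by positivity
    have hterm2 : 0 ≤ K * ((Real.exp (-(1 / 4) * ‖y‖ ^ 2) + ‖f (z - y)‖ ^ 2) / 2) := by positivity
    by_cases hy : ‖y‖ ≤ ρ
    · -- near the diagonal
      by_cases hzero : χ z = 0 ∧ χ (z - y) = 0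
      · rw [hzero.1, hzero.2, sub_self, abs_zero, zero_mul, mul_zero]
        exact add_nonneg hterm1 hterm2
      · -- one of the cutoffs is nonzero, so `z - y ∈ B(0, R)`
        have hzy : ‖z - y‖ < R := by
          rcases not_and_or.1 hzero with h1 | h1
          · have := hχsupp z h1
            calc ‖z - y‖ ≤ ‖z‖ + ‖y‖ := norm_sub_le _ _
              _ < R - ρ + ρ := add_lt_add_of_lt_of_le this hy
              _ = R := by ring
          · exact (hχsupp (z - y) h1).trans_le (by linarith)
        have h1 : |χ z - χ (z - y)| ≤ L * ‖y‖ := by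
          have := hχL z (z - y); rwa [sub_sub_cancel] at this
        calc heatKernel h y * (|χ z - χ (z - y)| * ‖f (z - y)‖)
            ≤ heatKernel h y * (L * ‖y‖ * m) :=
              mul_le_mul_of_nonneg_left (mul_le_mul h1 (hfm _ hzy) (norm_nonneg _)
                (by positivity)) hG0
          _ = m * L * (heatKernel h y * ‖y‖) := by ring
          _ ≤ g y := le_add_of_nonneg_right hterm2
    · -- off the diagonal
      push Not at hy
      have h1 : |χ z - χ (z - y)| ≤ 1 := by
        rw [abs_le]
        constructor <;> linarith [(hχ01 z).1, (hχ01 z).2, (hχ01 (z - y)).1, (hχ01 (z - y)).2]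
      have hGy : heatKernel h y ≤ K * Real.exp (-(1 / 8) * ‖y‖ ^ 2) := by
        have := heatKernel_le_of_le_norm hh hh1 hρ.le hy.le
        rw [hK]; exact this
      calc heatKernel h y * (|χ z - χ (z - y)| * ‖f (z - y)‖)
          ≤ K * Real.exp (-(1 / 8) * ‖y‖ ^ 2) * (1 * ‖f (z - y)‖) :=
            mul_le_mul hGy (mul_le_mul_of_nonneg_right h1 (norm_nonneg _)) (by positivity)
              (by positivity)
        _ = K * (Real.exp (-(1 / 8) * ‖y‖ ^ 2) * ‖f (z - y)‖) := by ring
        _ ≤ K * ((Real.exp (-(1 / 4) * ‖y‖ ^ 2) + ‖f (z - y)‖ ^ 2) / 2) :=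
            mul_le_mul_of_nonneg_left (exp_mul_le_half_add_sq y _) hK0
        _ ≤ g y := le_add_of_nonneg_left hterm1
  -- ### integrability and the integral of the dominating function
  have hIgauss : Integrable (fun y : E => Real.exp (-(1 / 4) * ‖y‖ ^ 2)) := by
    by_contra hni
    have h1 := GaussianFourier.integral_rexp_neg_mul_sq_norm (V := E) (b := 1 / 4) (by norm_num)
    rw [integral_undef hni] at h1
    have : (0 : ℝ) < (π / (1 / 4)) ^ ((Module.finrank ℝ E : ℝ) / 2) := by positivity
    exact this.ne h1
  have hIf2 : Integrable (fun y => ‖f (z - y)‖ ^ 2) := hfi.comp_sub_left z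
  have hIg : Integrable g := by
    refine (((integrable_heatKernel_mul_norm hh).const_mul (m * L))).add ?_
    exact ((hIgauss.add hIf2).div_const 2).const_mul K
  have hgauss : ∫ y : E, Real.exp (-(1 / 4) * ‖y‖ ^ 2) = (4 * π) ^ (d / 2) := by
    rw [GaussianFourier.integral_rexp_neg_mul_sq_norm (by norm_num : (0 : ℝ) < 1 / 4)]
    congr 1
    ring
  have hf2 : ∫ y, ‖f (z - y)‖ ^ 2 ≤ 𝓔 := by
    rw [integral_sub_left_eq_self (fun y => ‖f y‖ ^ 2) volume z]
    exact hfE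
  have hA : Integrable (fun y : E => m * L * (heatKernel h y * ‖y‖)) :=
    (integrable_heatKernel_mul_norm hh).const_mul _
  have hB : Integrable (fun y : E => K * ((Real.exp (-(1 / 4) * ‖y‖ ^ 2) + ‖f (z - y)‖ ^ 2) / 2)) :=
    ((hIgauss.add hIf2).div_const 2).const_mul K
  have hint_g : ∫ y, g y ≤ 2 * (2 : ℝ) ^ (d / 2) * m * L * Real.sqrt h +
      K * (((4 * π) ^ (d / 2) + 𝓔) / 2) := by
    simp only [hg]
    rw [integral_add hA hB, integral_const_mul, integral_const_mul, integral_div,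
      integral_add hIgauss hIf2, hgauss]
    have h1 : m * L * ∫ y : E, heatKernel h y * ‖y‖ ≤ 2 * (2 : ℝ) ^ (d / 2) * m * L * Real.sqrt h := by
      calc m * L * ∫ y : E, heatKernel h y * ‖y‖
          ≤ m * L * (2 * (2 : ℝ) ^ (d / 2) * h ^ (1 / 2 : ℝ)) :=
            mul_le_mul_of_nonneg_left (integral_heatKernel_mul_norm_le hh) (by positivity)
        _ = 2 * (2 : ℝ) ^ (d / 2) * m * L * Real.sqrt h := by rw [Real.sqrt_eq_rpow]; ring
    have h2 : K * (((4 * π) ^ (d / 2) + ∫ y, ‖f (z - y)‖ ^ 2) / 2) ≤ K * (((4 * π) ^ (d / 2) + 𝓔) / 2) :=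
      mul_le_mul_of_nonneg_left (by linarith) hK0
    exact add_le_add h1 h2
  -- ### assemble
  rw [hcomm]
  exact (norm_integral_le_of_norm_le hIg (Eventually.of_forall hpt)).trans hint_g

/-! ## §3 The off-diagonal factor in dimension three -/

/-- **The off-diagonal Gaussian factor is `O(√h)` with a constant vanishing as `ρ → ∞`**, in
dimension `3`: `(4πh)^{-3/2} e^{-ρ²/(8h)} ≤ 128 (4π)^{-3/2} ρ⁻⁴ √h` for `h > 0`, `ρ > 0`
(from `x²/2 ≤ eˣ` at `x = ρ²/(8h)`). [cite: Evans2010, §2.3.1] -/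
theorem offDiagonal_factor_le_sqrt {h ρ : ℝ} (hh : 0 < h) (hρ : 0 < ρ) :
    (4 * π * h) ^ (-(3 : ℝ) / 2) * Real.exp (-(ρ ^ 2 / (8 * h))) ≤
      128 * (4 * π) ^ (-(3 : ℝ) / 2) * (ρ ^ 4)⁻¹ * Real.sqrt h := by
  have hπ : 0 < 4 * π := by positivity
  set a : ℝ := ρ ^ 2 / (8 * h) with ha
  have ha0 : 0 < a := by rw [ha]; positivity
  -- `e^{-a} ≤ 2/a²`
  have hexp : Real.exp (-a) ≤ 2 / a ^ 2 := by
    have h1 : a ^ 2 / 2 ≤ Real.exp a := by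
      have := Real.quadratic_le_exp_of_nonneg ha0.le
      linarith
    rw [Real.exp_neg, inv_eq_one_div, div_le_div_iff₀ (Real.exp_pos a) (by positivity)]
    nlinarith
  -- `2/a² = 128 h²/ρ⁴`
  have ha2 : 2 / a ^ 2 = 128 * (ρ ^ 4)⁻¹ * h ^ 2 := by
    rw [ha]; field_simp; ring
  -- `(4πh)^{-3/2} = (4π)^{-3/2} h^{-3/2}` and `h^{-3/2} h² = h^{1/2} ≤ ...`
  have hsplit : (4 * π * h) ^ (-(3 : ℝ) / 2) = (4 * π) ^ (-(3 : ℝ) / 2) * h ^ (-(3 : ℝ) / 2) :=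
    Real.mul_rpow hπ.le hh.le
  have hpow : h ^ (-(3 : ℝ) / 2) * h ^ 2 = Real.sqrt h := by
    rw [Real.sqrt_eq_rpow, show (h ^ 2 : ℝ) = h ^ (2 : ℝ) by norm_cast, ← Real.rpow_add hh]
    norm_num
  calc (4 * π * h) ^ (-(3 : ℝ) / 2) * Real.exp (-(ρ ^ 2 / (8 * h)))
      = (4 * π) ^ (-(3 : ℝ) / 2) * h ^ (-(3 : ℝ) / 2) * Real.exp (-a) := by rw [hsplit, ha]
    _ ≤ (4 * π) ^ (-(3 : ℝ) / 2) * h ^ (-(3 : ℝ) / 2) * (128 * (ρ ^ 4)⁻¹ * h ^ 2) := by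
        rw [← ha2]; exact mul_le_mul_of_nonneg_left hexp (by positivity)
    _ = 128 * (4 * π) ^ (-(3 : ℝ) / 2) * (ρ ^ 4)⁻¹ * (h ^ (-(3 : ℝ) / 2) * h ^ 2) := by ring
    _ = 128 * (4 * π) ^ (-(3 : ℝ) / 2) * (ρ ^ 4)⁻¹ * Real.sqrt h := by rw [hpow]

/-! ## §4 The commutator estimate for every lag

For lags `h > 1` the off-diagonal Gaussian weight `e^{−‖y‖²/8}` of `heatKernel_le_of_le_norm` is
replaced by `e^{−‖y‖²/(8h)}` (valid for every `h > 0`), whose square-root Gaussian integrates to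
`(4πh)^{d/2}`; the far term becomes `e^{−ρ²/(8h)}/2 + (4πh)^{−d/2}e^{−ρ²/(8h)} 𝓔/2`. -/

omit [FiniteDimensional ℝ E] [MeasurableSpace E] [BorelSpace E] in
/-- Off-diagonal bound of the heat kernel for EVERY `h > 0`: for `δ ≤ ‖z‖`,
`G_h(z) ≤ (4πh)^{-d/2} e^{-δ²/(8h)} e^{-‖z‖²/(8h)}`. [cite: Evans2010, §2.3.1] -/
theorem heatKernel_le_of_le_norm_all {h δ : ℝ} (hh : 0 < h) (hδ : 0 ≤ δ) {z : E} (hz : δ ≤ ‖z‖) :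
    heatKernel h z ≤ (4 * π * h) ^ (-(Module.finrank ℝ E : ℝ) / 2) *
      Real.exp (-(δ ^ 2 / (8 * h))) * Real.exp (-(1 / (8 * h)) * ‖z‖ ^ 2) := by
  rw [heatKernel_eq]
  suffices key : Real.exp (-(1 / (4 * h)) * ‖z‖ ^ 2) ≤
      Real.exp (-(δ ^ 2 / (8 * h))) * Real.exp (-(1 / (8 * h)) * ‖z‖ ^ 2) by
    calc (4 * π * h) ^ (-(Module.finrank ℝ E : ℝ) / 2) * Real.exp (-(1 / (4 * h)) * ‖z‖ ^ 2)
        ≤ (4 * π * h) ^ (-(Module.finrank ℝ E : ℝ) / 2) *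
          (Real.exp (-(δ ^ 2 / (8 * h))) * Real.exp (-(1 / (8 * h)) * ‖z‖ ^ 2)) :=
          mul_le_mul_of_nonneg_left key (by positivity)
      _ = _ := by ring
  rw [← Real.exp_add]
  refine Real.exp_le_exp.2 ?_
  have h1 : δ ^ 2 ≤ ‖z‖ ^ 2 := pow_le_pow_left₀ hδ hz 2
  have h8 : 0 < 8 * h := by positivity
  have e : -(1 / (4 * h)) * ‖z‖ ^ 2 = -(‖z‖ ^ 2 / (8 * h)) + -(1 / (8 * h)) * ‖z‖ ^ 2 := by
    field_simp; ring
  rw [e]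
  have h2 : δ ^ 2 / (8 * h) ≤ ‖z‖ ^ 2 / (8 * h) := div_le_div_of_nonneg_right h1 h8.le
  linarith

omit [InnerProductSpace ℝ E] [FiniteDimensional ℝ E] [MeasurableSpace E] [BorelSpace E] in
/-- `2ab ≤ a² + b²` in the form `e^{−‖y‖²/(8h)} b ≤ (e^{−‖y‖²/(4h)} + b²)/2`. [folklore]
[cite: Evans2010, §2.3.1] -/
theorem exp_mul_le_half_add_sq_all (y : E) (b h : ℝ) :
    Real.exp (-(1 / (8 * h)) * ‖y‖ ^ 2) * b ≤ (Real.exp (-(1 / (4 * h)) * ‖y‖ ^ 2) + b ^ 2) / 2 := by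
  have h1 : Real.exp (-(1 / (8 * h)) * ‖y‖ ^ 2) ^ 2 = Real.exp (-(1 / (4 * h)) * ‖y‖ ^ 2) := by
    rw [← Real.exp_nat_mul]; congr 1; ring
  nlinarith [sq_nonneg (Real.exp (-(1 / (8 * h)) * ‖y‖ ^ 2) - b), h1]

/-- **The commutator of the heat flow with a Lipschitz cutoff, for EVERY lag `h > 0`.** As
`norm_heatCommutator_le` without `h ≤ 1`:
`‖χ(z) e^{hΔ}f(z) − e^{hΔ}(χ f)(z)‖ ≤ 2·2^{d/2} m L √h + (4πh)^{-d/2} e^{-ρ²/(8h)} ((4πh)^{d/2} + 𝓔)/2`.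
[cite: KochNadirashviliSereginSverak2009, §3 (3.7)–(3.8) and proof of Thm 6.2 (arXiv pp. 6, 13)] -/
theorem norm_heatCommutator_le_all {h R ρ m L M₀ 𝓔 : ℝ} {χ : E → ℝ} {f : E → F} (hh : 0 < h)
    (hρ : 0 < ρ) (hm : 0 ≤ m) (hL : 0 ≤ L)
    (hχ01 : ∀ y, 0 ≤ χ y ∧ χ y ≤ 1) (hχL : ∀ y z, |χ y - χ z| ≤ L * ‖y - z‖)
    (hχsupp : ∀ y, χ y ≠ 0 → ‖y‖ < R - ρ) (hχc : Continuous χ)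
    (hfc : Continuous f) (hfM : ∀ y, ‖f y‖ ≤ M₀) (hfm : ∀ y, ‖y‖ < R → ‖f y‖ ≤ m)
    (hfi : Integrable (fun y => ‖f y‖ ^ 2)) (hfE : ∫ y, ‖f y‖ ^ 2 ≤ 𝓔) (z : E) :
    ‖χ z • heatExtension f h z - heatExtension (fun y => χ y • f y) h z‖ ≤
      2 * (2 : ℝ) ^ ((Module.finrank ℝ E : ℝ) / 2) * m * L * Real.sqrt h +
        (4 * π * h) ^ (-(Module.finrank ℝ E : ℝ) / 2) * Real.exp (-(ρ ^ 2 / (8 * h))) *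
          (((4 * π * h) ^ ((Module.finrank ℝ E : ℝ) / 2) + 𝓔) / 2) := by
  set d : ℝ := (Module.finrank ℝ E : ℝ) with hd
  set K : ℝ := (4 * π * h) ^ (-d / 2) * Real.exp (-(ρ ^ 2 / (8 * h))) with hK
  have hK0 : 0 ≤ K := by rw [hK]; positivity
  have hM₀0 : 0 ≤ M₀ := (norm_nonneg _).trans (hfM 0)
  have hb : 0 < 1 / (4 * h) := by positivity
  -- ### the commutator as ONE integral
  have hχf_c : Continuous fun y => χ y • f y := hχc.smul hfc
  have hχf_b : ∀ y, ‖χ y • f y‖ ≤ M₀ := fun y => by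
    rw [norm_smul, Real.norm_of_nonneg (hχ01 y).1]
    exact (mul_le_of_le_one_left (norm_nonneg _) (hχ01 y).2).trans (hfM y)
  have hI1 : Integrable (fun y => heatKernel h y • f (z - y)) :=
    integrable_heatKernel_smul_of_bound hfc hfM hh z
  have hI2 : Integrable (fun y => heatKernel h y • (χ (z - y) • f (z - y))) :=
    integrable_heatKernel_smul_of_bound (g := fun y => χ y • f y) hχf_c hχf_b hh z
  have hI1' : Integrable (fun y => χ z • (heatKernel h y • f (z - y))) := hI1.smul (χ z)
  have hcomm : χ z • heatExtension f h z - heatExtension (fun y => χ y • f y) h z =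
      ∫ y, heatKernel h y • ((χ z - χ (z - y)) • f (z - y)) := by
    rw [heatExtension_apply, heatExtension_apply, ← integral_smul, ← integral_sub hI1' hI2]
    refine integral_congr_ae (Eventually.of_forall fun y => ?_)
    show χ z • (heatKernel h y • f (z - y)) - heatKernel h y • (χ (z - y) • f (z - y)) =
      heatKernel h y • ((χ z - χ (z - y)) • f (z - y))
    rw [smul_smul, smul_smul, smul_smul, ← sub_smul]
    congr 1
    ring
  -- ### the pointwise bound
  set g : E → ℝ := fun y => m * L * (heatKernel h y * ‖y‖) +
    K * ((Real.exp (-(1 / (4 * h)) * ‖y‖ ^ 2) + ‖f (z - y)‖ ^ 2) / 2) with hg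
  have hpt : ∀ y, ‖heatKernel h y • ((χ z - χ (z - y)) • f (z - y))‖ ≤ g y := by
    intro y
    have hG0 : 0 ≤ heatKernel h y := (heatKernel_pos hh y).le
    rw [norm_smul, norm_smul, Real.norm_of_nonneg hG0, Real.norm_eq_abs]
    have hterm1 : 0 ≤ m * L * (heatKernel h y * ‖y‖) := by positivity
    have hterm2 : 0 ≤ K * ((Real.exp (-(1 / (4 * h)) * ‖y‖ ^ 2) + ‖f (z - y)‖ ^ 2) / 2) := by
      positivity
    by_cases hy : ‖y‖ ≤ ρ
    · by_cases hzero : χ z = 0 ∧ χ (z - y) = 0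
      · rw [hzero.1, hzero.2, sub_self, abs_zero, zero_mul, mul_zero]
        exact add_nonneg hterm1 hterm2
      · have hzy : ‖z - y‖ < R := by
          rcases not_and_or.1 hzero with h1 | h1
          · have := hχsupp z h1
            calc ‖z - y‖ ≤ ‖z‖ + ‖y‖ := norm_sub_le _ _
              _ < R - ρ + ρ := add_lt_add_of_lt_of_le this hy
              _ = R := by ring
          · exact (hχsupp (z - y) h1).trans_le (by linarith)
        have h1 : |χ z - χ (z - y)| ≤ L * ‖y‖ := by
          have := hχL z (z - y); rwa [sub_sub_cancel] at this
        calc heatKernel h y * (|χ z - χ (z - y)| * ‖f (z - y)‖)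
            ≤ heatKernel h y * (L * ‖y‖ * m) :=
              mul_le_mul_of_nonneg_left (mul_le_mul h1 (hfm _ hzy) (norm_nonneg _)
                (by positivity)) hG0
          _ = m * L * (heatKernel h y * ‖y‖) := by ring
          _ ≤ g y := le_add_of_nonneg_right hterm2
    · push Not at hy
      have h1 : |χ z - χ (z - y)| ≤ 1 := by
        rw [abs_le]
        constructor <;> linarith [(hχ01 z).1, (hχ01 z).2, (hχ01 (z - y)).1, (hχ01 (z - y)).2]
      have hGy : heatKernel h y ≤ K * Real.exp (-(1 / (8 * h)) * ‖y‖ ^ 2) := by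
        have := heatKernel_le_of_le_norm_all hh hρ.le hy.le
        rw [hK]; exact this
      calc heatKernel h y * (|χ z - χ (z - y)| * ‖f (z - y)‖)
          ≤ K * Real.exp (-(1 / (8 * h)) * ‖y‖ ^ 2) * (1 * ‖f (z - y)‖) :=
            mul_le_mul hGy (mul_le_mul_of_nonneg_right h1 (norm_nonneg _)) (by positivity)
              (by positivity)
        _ = K * (Real.exp (-(1 / (8 * h)) * ‖y‖ ^ 2) * ‖f (z - y)‖) := by ring
        _ ≤ K * ((Real.exp (-(1 / (4 * h)) * ‖y‖ ^ 2) + ‖f (z - y)‖ ^ 2) / 2) :=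
            mul_le_mul_of_nonneg_left (exp_mul_le_half_add_sq_all y _ h) hK0
        _ ≤ g y := le_add_of_nonneg_left hterm1
  -- ### integrability and the integral of the dominating function
  have hIgauss : Integrable (fun y : E => Real.exp (-(1 / (4 * h)) * ‖y‖ ^ 2)) := by
    by_contra hni
    have h1 := GaussianFourier.integral_rexp_neg_mul_sq_norm (V := E) hb
    rw [integral_undef hni] at h1
    have : (0 : ℝ) < (π / (1 / (4 * h))) ^ ((Module.finrank ℝ E : ℝ) / 2) := by positivity
    exact this.ne h1
  have hIf2 : Integrable (fun y => ‖f (z - y)‖ ^ 2) := hfi.comp_sub_left z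
  have hgauss : ∫ y : E, Real.exp (-(1 / (4 * h)) * ‖y‖ ^ 2) = (4 * π * h) ^ (d / 2) := by
    rw [GaussianFourier.integral_rexp_neg_mul_sq_norm hb]
    congr 1
    field_simp
  have hf2 : ∫ y, ‖f (z - y)‖ ^ 2 ≤ 𝓔 := by
    rw [integral_sub_left_eq_self (fun y => ‖f y‖ ^ 2) volume z]
    exact hfE
  have hA : Integrable (fun y : E => m * L * (heatKernel h y * ‖y‖)) :=
    (integrable_heatKernel_mul_norm hh).const_mul _
  have hB : Integrable (fun y : E =>
      K * ((Real.exp (-(1 / (4 * h)) * ‖y‖ ^ 2) + ‖f (z - y)‖ ^ 2) / 2)) :=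
    ((hIgauss.add hIf2).div_const 2).const_mul K
  have hIg : Integrable g := hA.add hB
  have hint_g : ∫ y, g y ≤ 2 * (2 : ℝ) ^ (d / 2) * m * L * Real.sqrt h +
      K * (((4 * π * h) ^ (d / 2) + 𝓔) / 2) := by
    simp only [hg]
    rw [integral_add hA hB, integral_const_mul, integral_const_mul, integral_div,
      integral_add hIgauss hIf2, hgauss]
    have h1 : m * L * ∫ y : E, heatKernel h y * ‖y‖ ≤ 2 * (2 : ℝ) ^ (d / 2) * m * L * Real.sqrt h := by
      calc m * L * ∫ y : E, heatKernel h y * ‖y‖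
          ≤ m * L * (2 * (2 : ℝ) ^ (d / 2) * h ^ (1 / 2 : ℝ)) :=
            mul_le_mul_of_nonneg_left (integral_heatKernel_mul_norm_le hh) (by positivity)
        _ = 2 * (2 : ℝ) ^ (d / 2) * m * L * Real.sqrt h := by rw [Real.sqrt_eq_rpow]; ring
    have h2 : K * (((4 * π * h) ^ (d / 2) + ∫ y, ‖f (z - y)‖ ^ 2) / 2) ≤
        K * (((4 * π * h) ^ (d / 2) + 𝓔) / 2) :=
      mul_le_mul_of_nonneg_left (by linarith) hK0
    exact add_le_add h1 h2
  rw [hcomm]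
  exact (norm_integral_le_of_norm_le hIg (Eventually.of_forall hpt)).trans hint_g

end Literature.Analysis.FluidPDE

end
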